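import Literature.AnabelianGeometry.EtaleTheta.KummerEquivariance
import Summits.ABC.IUTFork.LanaKummerTower
import HarnessLib

/-!
# L-LANA objects XII quater: `G_v`-equivariance of `κ : K̄_v^× → lim_{→ H} H¹(H, Λ)` (LANA §6.1) — PROVED

Proof-only companion (theorems, no definitions) of `LanaKummerTower.lean` (seat abc-iut-c312-4, L-LANA level,
plan/LLANA-SPEC N13); TAKES NO SIDE on [IUTchIII] Cor. 3.12. LANA §6.1 p. 31: "`κ : M → lim_{→ H} H¹(H, Λ(M))`.
This map is `G`-equivariant with respect to the natural action of `G` on `H¹`." For the CONSTRUCTED tower at a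
nonarchimedean place (`AlgCl.kummerTower`, over the system of open normal subgroups of `G_v = Gal(K̄_v/K_v)`) the
natural action of `σ ∈ G_v` on `∞H¹ = lim_{→ H} H¹(H, Λ(K̄_v^×))` is seat abc-iut-L2-t3's
`CoMorphism.conjColimMap` (conjugation on each normal `H`, `σ • –` on `Λ`, compatible with restriction;
`KummerEquivariance.lean`), and the equivariance `σ ⋆ κ(a) = κ(σ • a)` is L2-t3's `conjColimMap_kummerMap`
instantiated — `AlgCl.conjColimMap_kummerTower`; restricted to `O^▷_{K̄_v}` (§6.2 (g) "`κ_t : O^▷_{v,t} →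
∞H¹(D_t, Λ_{v,t})`"), `AlgCl.conjColimMap_kummerTowerInt`; on the invariant parts `K_v^× = (K̄_v^×)^{G_v}`,
`O^▷_v = (O^▷_{K̄_v})^{G_v}` (§3.9) the values are `G_v`-fixed classes.
[cite: LANA2026Report, §6.1 p. 31, §6.2 (g) p. 35, §3.9 p. 21] NOT here: any judgement.
-/

noncomputable section

namespace Summit.ABC
namespace IUTFork
namespace AlgCl

open Literature.AnabelianGeometry.EtaleTheta

section Units

variable (K₀ : Type) [NontriviallyNormedField K₀] [CharZero K₀]

/-- **`G_v`-EQUIVARIANCE of `κ : K̄_v^× → ∞H¹`** ("This map is `G`-equivariant with respect to the natural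
action of `G` on `H¹`"): `σ ⋆ κ(a) = κ(σ • a)`, the action on `∞H¹` being L2-t3's `conjColimMap` for the system of
open normal subgroups of `G_v`. [cite: LANA2026Report, §6.1 p. 31] -/
theorem conjColimMap_kummerTower (σ : Gal K₀) (a : (AlgCl K₀)ˣ) :
    CoMorphism.conjColimMap (levelSubgroup K₀) (levelSubgroup_anti K₀) σ (kummerTower K₀ (Additive.ofMul a)) =
      kummerTower K₀ (Additive.ofMul (σ • a)) :=
  CoMorphism.conjColimMap_kummerMap (levelSubgroup K₀) (levelSubgroup_anti K₀) (isExhausted_units K₀) σ a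

/-- `κ` of a `G_v`-INVARIANT unit (an element of `K_v^× = (K̄_v^×)^{G_v}`, §4.2 (b)) is a `G_v`-fixed class of
`∞H¹`. [cite: LANA2026Report, §6.1 p. 31, §4.2 (b) p. 26] -/
theorem conjColimMap_kummerTower_of_mem_invariants (σ : Gal K₀) (a : (AlgCl K₀)ˣ)
    (ha : a ∈ invariants (A := (AlgCl K₀)ˣ) (⊤ : Subgroup (Gal K₀))) :
    CoMorphism.conjColimMap (levelSubgroup K₀) (levelSubgroup_anti K₀) σ (kummerTower K₀ (Additive.ofMul a)) =
      kummerTower K₀ (Additive.ofMul a) := by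
  rw [conjColimMap_kummerTower]
  have h : σ • a = a := ha ⟨σ, trivial⟩
  rw [h]

end Units

section IntMonoid

variable (K₀ : Type) [NontriviallyNormedField K₀] [CompleteSpace K₀] [IsUltrametricDist K₀] [CharZero K₀]

/-- **`G_v`-equivariance of the local Kummer map on `O^▷_{K̄_v}`** (§6.2 (g)): `σ ⋆ κ(a) = κ(σ • a)`.
[cite: LANA2026Report, §6.1 p. 31, §6.2 (g) p. 35] -/
theorem conjColimMap_kummerTowerInt (σ : Gal K₀) (a : intMonoid (val K₀)) :
    CoMorphism.conjColimMap (levelSubgroup K₀) (levelSubgroup_anti K₀) σ (kummerTowerInt K₀ a).toAdd =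
      (kummerTowerInt K₀ (σ • a)).toAdd := by
  rw [toAdd_kummerTowerInt, toAdd_kummerTowerInt, conjColimMap_kummerTower, intMonoidToUnits_smul]

/-- `κ` on the invariant part `O^▷_v := (O^▷_{K̄_v})^{G_v}` (§3.9 "version without an overline") takes `G_v`-fixed
values in `∞H¹`. [cite: LANA2026Report, §3.9 p. 21, §6.1 p. 31] -/
theorem conjColimMap_kummerTowerInt_of_mem (σ : Gal K₀) (a : intMonoid (val K₀))
    (ha : a ∈ intMonoidInv (val K₀) (Gal K₀)) :
    CoMorphism.conjColimMap (levelSubgroup K₀) (levelSubgroup_anti K₀) σ (kummerTowerInt K₀ a).toAdd =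
      (kummerTowerInt K₀ a).toAdd := by
  rw [conjColimMap_kummerTowerInt]
  have h : σ • a = a := ha σ
  rw [h]

end IntMonoid

end AlgCl

end IUTFork

end Summit.ABC

end
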